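import Literature.NumberTheory.LFunctions.Zhang2022.RepairJumpBlock
import Literature.NumberTheory.LFunctions.Zhang2022.RepairWallBand
import Literature.NumberTheory.LFunctions.Zhang2022.KnifeEdgeRoughOverhang
import Literature.NumberTheory.LFunctions.Zhang2022.RepairAdmissibleShiftFree
import Literature.NumberTheory.LFunctions.Zhang2022.RepairRplusJoint
import Literature.NumberTheory.LFunctions.Zhang2022.KnifeEdgeThreePiece
import Literature.NumberTheory.LFunctions.Zhang2022.RepairFarBV
import Literature.NumberTheory.LFunctions.Zhang2022.RepairLambdaBlock
import Literature.NumberTheory.LFunctions.Zhang2022.RepairGramBlock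

/-!
# Zhang (2022), programme F-S3 §E (cell landau-siegel, barrier extension, seat p3, stub S-E-p3-4): INTAKE of the
# §B word KILL(B-multi) — the class `K_multi` as ONE design family `familyBmulti` over a sum design type, one
# constructor per sub-class of the word, each dispatched to its LANDED `R⁺⁺` family; `bmultiWord` decided (v1)

Y. Zhang, *Discrete mean estimates and the Landau–Siegel zero*, arXiv:2211.02515v1 [Zhang2022LandauSiegel] —
an unrefereed manuscript under adjudication. **WHAT THIS IS NOT: not a claim about Theorems 1–2 of
arXiv:2211.02515, about Landau–Siegel zeros, about a repaired `Margin232`, or about Parity; nothing here asserts any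
claim of the manuscript or any estimate. The programme SEARCHES and TYPES; no claim until a kernel theorem says so.**
Intake file of record for the cell's first §B word (KILL-INTAKE.md v1.2 §1, COVERAGE.md v1.4, barrier/ASSIGNMENTS.md
row S-E-p3-4); nothing is re-proved: every verdict below is a landed `_decided` term.

## The word (C1 — verbatim)

director-frontier g5, cell INBOX 2026-08-26T18:10:26Z: «**§B-multi KILL** … family B-multi = K_multi is CLOSED with
the KILL sentence of record KILL-CERT v2.1 ec49ecfde40ed80b §1 / DESIGN-MAP-multi v1.1 f93a6bc33ed022d5 …:
«no d in K_multi (interior jumps ∪ wall/band ∪ bounded-variation far features ∪ Λ-type pieces, mixed members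
included) closes at main order without an E*-len/E*-ℓ-strength input» — every displayed slot a LANDED theorem
(E-028 p458438 · E-005/E-034/E-035 p458037 · E-006/E-035-discrete p459102 · E-030 p459168 · far E-033
p457384/p457577/p457806), candidates 0, NO NUMBER LOAD-BEARING …». KILL-CERT (HOME/B-multi/KILL-draft.md, v2.1
ec49ecfde40ed80b = text of record; v2.2 header-only update) §1 sentence, abridged to its logical content: every term
any member displays — bulk (4.1) form of each `H¹` block, interior-jump term (E-028), band term `V = |c|²K[b]`
(E-005/E-034), bulk×band cross (E-006), Λ-class block (E-030) — is an entry of ONE Hermitian main-term matrix `G_d` on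
the finite span of the member's pieces, read off the PSD discrete form `Σ_ρ 𝔠*ω|H_d(ρ)|²` (Lemma 2.3, weights `≥ 0`);
bulk `n < P·T⁻²` = Prop 7.1's MODEL (the (4.1) form, `mainTermForm_nonneg_of_isH1`); band / jump / cross / Λ terms =
DISPLAYED SLOTS; far `n > P^{1+ε₀}` = THEOREM (E-033); hence `OBJ(d) = xᵀG_d x ≥ 0` at main order for every
`d ∈ K_multi` GIVEN the displayed slot `GramPSD(G_d)`, whose 1- and 2-block instances are `JumpKernelPos` (E-028),
`bandK ≥ 0` (E-034, PROVED) ∧ `WallCrossCS` (E-006), LambdaBlock-CS (E-030); closing would require the NEGATION of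
a displayed slot at main order (E-035, or an indefinite Λ-block).

## The class `K_multi` (KILL-CERT §2 (a), REF-B1-countersigned class text) and its dispatch (this file)

Common box: `fam = multi`; `ℓ = 1`; detector `b = (1,2,3)`, weights cstar-printed or cstar-S; endgame ∈ {CS, POS};
pieces PPE(ℚ[i]) on rational supports ⊂ `[0,2]`; `cut₁ ∈ (0,1)` free. Sub-classes ↦ constructor of `BmultiDesign` ↦
covering family ↦ currency ↦ displayed slot(s):

| sub-class of the word | constructor | family (file, p-id) | currency | displayed slot(s) (registry) |
|---|---|---|---|---|
| M0: multi-piece `H¹` bulk, tops `≤ 1`, wall values `0` (R̄ part) | `m0 g g' f f'` | `Repair.familyH1` (RepairRplus, p455670) | 𝔅 / polar CS (continued calculus = (4.1) identity region) | none; GUARD G1: the class states `g(1) = f(1) = 0` |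
| (L-a.i) M1: interior jumps `J ⊂ (0, z_w)`, balanced amplitudes, kernel `κ` a coordinate | `m1 κ J` | `Repair.familyJumpBlockAll` (RepairJumpBlock, p4 S-E-p4-3) | (A)-world MODEL main term, balanced reading | `∀ z ∈ (0,1), 0 ≤ κ z` (E-028; `JumpKernelPos`) |
| (L-a.ii) M3: wall value `u(1⁻)` FREE + band datum `W = (h⁺, b)` | `m3wall u u' W` | `KnifeEdge.familyWallBand` (RepairWallBand, p459421) | (A)-world MODEL main term `wallMainTerm` (E-034 HEURISTIC; bulk entry `𝔅(u)` at `u(1⁻) ≠ 0` is the (4.1) MODEL — KILL-CERT §5 / Q→theory-3, no 𝔅-currency dictionary claim) | `∀ b, 0 ≤ K b` (E-005/E-034; `bandK_nonneg` proved), `WallCrossCS K X` (E-006; discrete CS a theorem, p459102) |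
| (L-a.ii) sub-case «cut at `z_w` / band sliver»: in-class `u` (`u(1⁻) = 0`) ⊕ ROUGH overhang `v` on `[1,θ]` | `m3overhang θ u u' v v' s` | `KnifeEdge.familyRoughTwoPiece` (KnifeEdgeRoughOverhang, p457552; smooth joint currency: `Repair.familyTwoPieceJoint` p457753, in `Repair.Rplusplus2`) | `X`-world (continued blocks + off-diagonal `X`) | `BandNonnegOn` (E-005 object `netOverhangBlock`), `CrossSubordinateOn` (E-006 object `crossResidual`) |
| M4: BCY reflected piece = Zhang's glue, any `Theta` box with lengths in `(0,1]` | `m4 θ` | `Repair.familyRLengths` (RepairAdmissibleShiftFree, p457555) ⊇ `familyR` | continued calculus (T-true); validity off `R`: E-017 open (text) | none |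
| (L-a.iii) far bounded-variation features on `[1+ε₀, 2]` | — (v2) | THEOREM E-033: `KnifeEdgeInvisibleTail.tailInvisible_bv` p457577, `discMeanFlat_bv` p457806; family wrap `familyFarBV` pending (typer-2, S-E-t2-1) | discrete mean, `Re ρ = ½` displayed | none — decided by theorem |
| (L-b) M2: Λ-type blocks `k ∈ {1,2}`, tops `≤ 1` | — (v2) | `familyLambdaBlock` pending (p5 g2, S-E-p5-3, over p459168) | MODEL main term | `LambdaDiagNonneg`, `LambdaBlockCS` (E-030; inert by price) |
| MIXED members (`k ≥ 3` blocks at once) | — (v2) | `familyGramBlock` pending (p2, S-E-p2-4, over typer-1's KnifeEdgeGramPSD p460485) | discrete: theorem under weights `≥ 0`; model: slot `GramPSD` | Gram matrix PSD (pairwise CS insufficient for `k ≥ 3`); NOTE: p458438's `jumpMainTerm` CLAIMS vanishing pure-jump crosses (derivation claim E-028) — the word rests only on GramPSD |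

EXITS (KILL-CERT §2/§8, NOT in `K_multi`, each of E*-len strength; recorded, no theorem): divisor-type coefficients
(E-031), `μψ`-one-sided at top `> 1`, general bounded `a(n)` beyond `P`, Λ-type with top `> 1`, E-035 itself,
sign-indefinite detectors (O4). Guards of record (COVERAGE.md): G1 — 𝔅-currency families represent the (A)-world main
term only through the (4.1) dictionary, which needs `g(1) = 0`: the `m0` constructor CARRIES `g(1) = f(1) = 0`;
members with a nonzero left wall value are `m3wall` (model currency), never `m0`. G2 — several bulk pieces with
independent scalars: in-class pieces form a subspace (`Repair.KinkedProfile.add_smul`), covered. G3 — no word in a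
HEURISTIC currency is countersigned (B-ell): not this word.

## What this file provides (v1; the pending families enter as the VERSIONED `bmultiWord2` / `familyBmulti2` appended to this append-only file — v1 decls stay frozen)

`BmultiDesign` (sum type), `KBmulti` (class), `VBmulti` (verdict = the covering family's verdict, slots displayed
there), `familyBmulti : Repair.DesignFamily`, `familyBmulti_decided` (by cases, from `not_repairable_in_Rplus`,
`familyJumpBlockAll_decided`, `familyWallBand_decided`, `familyRoughTwoPiece_decided`, `familyRLengths_decided`);
the per-constructor identities with the families (`Iff.rfl`, C2 by term) and embeddings (`InRplus` designs ↦ `m0`/`m4`,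
`familyTwoPiece` ↦ `m3overhang`); `bmultiWord : List DesignFamily` (the five landed families) with `bmultiWord_decided`,
`rplus_bmultiWord_decided : ClassDecided (Rplus ++ bmultiWord)`, `rplus_bmulti_decided : ClassDecided (Rplus ++ [familyBmulti])`;
C4 witnesses FROM THE FAMILY'S FILES: multi-wall-002 literal (`ϰ(21/20, 5/2)` truncated at the wall, wall value
`(1/21)e^{iπ/8} ≠ 0`, flat band at that height — `kinkedProfile_kappaP_long`, `kappaP_one_ne_zero`,
`inClass_wall002`), the BPRZ-type interior step (p4's `jumpStar`), `g⋆ ⊕ 𝟙_[1,θ)` (rough overhang), `θ₀` (M4), and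
`g⋆` (M0). Pending at word time (v2): `familyLambdaBlock` (p5), `familyGramBlock` (p2), `familyFarBV` (typer-2).
References: Zhang, arXiv:2211.02515v1, §2 (2.23)–(2.25), (2.30), (2.32)–(2.33), §7 Prop 7.1 (7.2), §8 Lemma 8.1,
§10 (10.5) [cite: Zhang2022LandauSiegel, §2 (2.32)–(2.33); §7 Prop 7.1 (7.2)]; cell files B-multi/KILL-draft.md
(KILL-CERT), barrier/ASSIGNMENTS.md S-E-p3-4, ls-barrier-plan/KILL-INTAKE.md v1.2, COVERAGE.md v1.4.
-/

noncomputable section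

open Complex Real Set
open _root_.MeasureTheory

namespace Literature.NumberTheory.LFunctions.Zhang2022

namespace Repair

open KnifeEdge

/-! ### Part 1 — the design type of `K_multi` (one constructor per sub-class of the word), class and verdict -/

/-- **Designs of the killed class `K_multi`** (KILL-CERT §2), one constructor per sub-class with a landed `R⁺⁺`
family: `m0` = M0 (a pair of `H¹` bulk profiles: glued side profile and probe, tops `≤ 1`, wall values `0`);
`m1` = M1 interior jumps with the kernel `κ` as a coordinate (`JumpData` of p458438); `m3wall` = M3 with FREE wall
value and band datum (`WallData` of p458037); `m3overhang` = M3 sub-case «cut at `z_w` / band sliver» (in-class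
`u`, rough overhang `v` on `[1,θ]`, scalar `s`); `m4` = M4 / any `Theta` box. (M2, MIXED, far-BV: versioned `BmultiDesign2`
appended when their families land; this type is frozen.)
[cite: Zhang2022LandauSiegel, §2 (2.32)–(2.33); §7 Prop 7.1 (7.2)] -/
inductive BmultiDesign : Type
  | m0 (g g' f f' : ℝ → ℂ)
  | m1 (κ : ℝ → ℝ) (J : JumpData)
  | m3wall (u u' : ℝ → ℂ) (W : WallData)
  | m3overhang (θ : ℝ) (u u' v v' : ℝ → ℂ) (s : ℂ)
  | m4 (θ : Theta)

/-- **Membership in `K_multi`** (class conjuncts only — NO analytic hypothesis): `m0`: both profiles `H¹` on `[0,1]`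
AND `g(1) = f(1) = 0` (guard G1 stated); `m1`: `J.Admissible` (kinked continuous part with `u(1) = 0`, interior jumps);
`m3wall`: `KinkedProfile u u'` (wall value free); `m3overhang`: `1 ≤ θ ∧ InClassPiece u u' ∧ RoughOverhangPiece θ v v'`;
`m4`: `θ.lengthsInUnit`. [cite: Zhang2022LandauSiegel, §2 (2.32)–(2.33); §7 Prop 7.1 (7.2)] -/
def KBmulti : BmultiDesign → Prop
  | .m0 g g' f f' => IsH1OnUnitInterval g g' ∧ IsH1OnUnitInterval f f' ∧ g 1 = 0 ∧ f 1 = 0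
  | .m1 κ J => familyJumpBlockAll.InClass (κ, J)
  | .m3wall u u' W => familyWallBand.InClass (u, u', W)
  | .m3overhang θ u u' v v' s => familyRoughTwoPiece.InClass (θ, u, u', v, v', s)
  | .m4 θ => familyRLengths.InClass θ

/-- **The verdict «no main-order closing»**, sub-class by sub-class, = the covering family's verdict with its slots
DISPLAYED there: `m0`: `¬ (𝔅(g)𝔅(f) < ‖P(g,f)‖²)`; `m1`: `(∀ z ∈ (0,1), 0 ≤ κ z) → 0 ≤ jumpMainTerm κ J`; `m3wall`:
`∀ K X, (∀ b, 0 ≤ K b) → WallCrossCS K X → ¬ (wallMainTerm K X u u' W < 0)`; `m3overhang`: `∀ X, BandNonnegOn … →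
CrossSubordinateOn … → ¬ (twoPieceMainTerm θ X u u' v v' s < 0)`; `m4`: `¬ (C232S θ · C233T θ < ‖dSumS θ‖²)`.
[cite: Zhang2022LandauSiegel, §2 (2.32)–(2.33); §7 Prop 7.1 (7.2)] -/
def VBmulti : BmultiDesign → Prop
  | .m0 g g' f f' => familyH1.Verdict (g, g', f, f')
  | .m1 κ J => familyJumpBlockAll.Verdict (κ, J)
  | .m3wall u u' W => familyWallBand.Verdict (u, u', W)
  | .m3overhang θ u u' v v' s => familyRoughTwoPiece.Verdict (θ, u, u', v, v', s)
  | .m4 θ => familyRLengths.Verdict θ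

/-- **The killed class as ONE family** `familyBmulti = ⟨BmultiDesign, KBmulti, VBmulti⟩`.
[cite: Zhang2022LandauSiegel, §2 (2.32)–(2.33); §7 Prop 7.1 (7.2)] -/
def familyBmulti : DesignFamily where
  Design := BmultiDesign
  InClass := KBmulti
  Verdict := VBmulti

/-- **`K_multi` (v1: M0, M1, M3-wall, M3-overhang, M4) IS DECIDED** — by cases, from the landed terms
`not_repairable_in_Rplus (.hOne …)` (p455670), `familyJumpBlockAll_decided` (p4), `familyWallBand_decided` (p459421),
`familyRoughTwoPiece_decided` (p457552), `familyRLengths_decided` (p457555); nothing re-proved.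
[cite: Zhang2022LandauSiegel, §2 (2.32)–(2.33); §7 Prop 7.1 (7.2)] -/
theorem familyBmulti_decided : familyBmulti.Decided
  | .m0 g g' f f', h => not_repairable_in_Rplus (.hOne g g' f f') ⟨h.1, h.2.1⟩
  | .m1 κ J, h => familyJumpBlockAll_decided (κ, J) h
  | .m3wall u u' W, h => familyWallBand_decided (u, u', W) h
  | .m3overhang θ u u' v v' s, h => familyRoughTwoPiece_decided (θ, u, u', v, v', s) h
  | .m4 θ, h => familyRLengths_decided θ h

/-- **`R⁺ ++ [K_multi]` is decided** (`Repair.rplus_extend`). [cite: Zhang2022LandauSiegel, §2 (2.32)–(2.33)] -/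
theorem rplus_bmulti_decided : ClassDecided (Rplus ++ [familyBmulti]) :=
  rplus_extend familyBmulti_decided

/-! ### Part 2 — the word as a LIST of the covering families (v1 = the five landed ones) -/

/-- **The word's families, v1**: `[familyH1, familyJumpBlockAll, familyWallBand, familyRoughTwoPiece, familyRLengths]`
(pending at word time, to be appended as the versioned `bmultiWord2 := bmultiWord ++ […]`: `familyLambdaBlock` (M2, p5),
`familyGramBlock` (MIXED, p2), `familyFarBV` ((L-a.iii), typer-2)). [cite: Zhang2022LandauSiegel, §2 (2.32)–(2.33); §7 Prop 7.1 (7.2)] -/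
def bmultiWord : List DesignFamily :=
  [familyH1, familyJumpBlockAll, familyWallBand, familyRoughTwoPiece, familyRLengths]

/-- **The word's families are decided.** [cite: Zhang2022LandauSiegel, §2 (2.32)–(2.33); §7 Prop 7.1 (7.2)] -/
theorem bmultiWord_decided : ClassDecided bmultiWord :=
  classDecided_cons (fun p h => not_repairable_in_Rplus (.hOne p.1 p.2.1 p.2.2.1 p.2.2.2) h) <|
    classDecided_cons familyJumpBlockAll_decided <|
      classDecided_cons familyWallBand_decided <|
        classDecided_cons familyRoughTwoPiece_decided <|
          classDecided_cons familyRLengths_decided classDecided_nil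

/-- **`R⁺ ++ bmultiWord` is decided.** [cite: Zhang2022LandauSiegel, §2 (2.32)–(2.33)] -/
theorem rplus_bmultiWord_decided : ClassDecided (Rplus ++ bmultiWord) :=
  classDecided_append.2 ⟨rplus_decided, bmultiWord_decided⟩

/-- The families of the word, by name. [cite: Zhang2022LandauSiegel, §2 (2.32)–(2.33)] -/
theorem mem_bmultiWord_iff (F : DesignFamily) :
    F ∈ bmultiWord ↔ F = familyH1 ∨ F = familyJumpBlockAll ∨ F = familyWallBand ∨ F = familyRoughTwoPiece ∨
      F = familyRLengths := by
  simp only [bmultiWord, List.mem_cons, List.not_mem_nil, or_false]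

/-! ### Part 3 — C2 by term: each constructor IS its family; the decided classes embed -/

/-- `m0` is `familyH1` with the guard `g(1) = f(1) = 0` added to the class (verdict identical).
[cite: Zhang2022LandauSiegel, §2 (2.32)–(2.33)] -/
theorem kbmulti_m0_iff (g g' f f' : ℝ → ℂ) :
    (KBmulti (.m0 g g' f f') ↔ familyH1.InClass (g, g', f, f') ∧ g 1 = 0 ∧ f 1 = 0) ∧
      (VBmulti (.m0 g g' f f') ↔ familyH1.Verdict (g, g', f, f')) :=
  ⟨⟨fun h => ⟨⟨h.1, h.2.1⟩, h.2.2⟩, fun h => ⟨h.1.1, h.1.2, h.2⟩⟩, Iff.rfl⟩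

/-- `m1` is `familyJumpBlockAll` (class and verdict, by `Iff.rfl`). [cite: Zhang2022LandauSiegel, §7 Prop 7.1 (7.2)] -/
theorem kbmulti_m1_iff (κ : ℝ → ℝ) (J : JumpData) :
    (KBmulti (.m1 κ J) ↔ familyJumpBlockAll.InClass (κ, J)) ∧ (VBmulti (.m1 κ J) ↔ familyJumpBlockAll.Verdict (κ, J)) :=
  ⟨Iff.rfl, Iff.rfl⟩

/-- `m3wall` is `familyWallBand` (class and verdict, by `Iff.rfl`). [cite: Zhang2022LandauSiegel, §7 Prop 7.1 (7.2)] -/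
theorem kbmulti_m3wall_iff (u u' : ℝ → ℂ) (W : WallData) :
    (KBmulti (.m3wall u u' W) ↔ familyWallBand.InClass (u, u', W)) ∧
      (VBmulti (.m3wall u u' W) ↔ familyWallBand.Verdict (u, u', W)) :=
  ⟨Iff.rfl, Iff.rfl⟩

/-- `m3overhang` is `familyRoughTwoPiece` (class and verdict, by `Iff.rfl`). [cite: Zhang2022LandauSiegel, §7 Prop 7.1 (7.2)] -/
theorem kbmulti_m3overhang_iff (θ : ℝ) (u u' v v' : ℝ → ℂ) (s : ℂ) :
    (KBmulti (.m3overhang θ u u' v v' s) ↔ familyRoughTwoPiece.InClass (θ, u, u', v, v', s)) ∧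
      (VBmulti (.m3overhang θ u u' v v' s) ↔ familyRoughTwoPiece.Verdict (θ, u, u', v, v', s)) :=
  ⟨Iff.rfl, Iff.rfl⟩

/-- `m4` is `familyRLengths` (class and verdict, by `Iff.rfl`). [cite: Zhang2022LandauSiegel, §2 (2.32)–(2.33)] -/
theorem kbmulti_m4_iff (θ : Theta) :
    (KBmulti (.m4 θ) ↔ familyRLengths.InClass θ) ∧ (VBmulti (.m4 θ) ↔ familyRLengths.Verdict θ) :=
  ⟨Iff.rfl, Iff.rfl⟩

/-- EMBEDDING: every class-`R` design is an `m4` member (`AdmissibleTheta.lengthsInUnit`).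
[cite: Zhang2022LandauSiegel, §2 (2.32)–(2.33)] -/
theorem kbmulti_m4_of_admissible {θ : Theta} (h : AdmissibleTheta θ) : KBmulti (.m4 θ) := h.lengthsInUnit

/-- EMBEDDING: every smooth two-piece design of `R⁺` (`Repair.InRplus (.twoPiece …)`) is an `m3overhang` member
(`KnifeEdge.OverhangPiece.rough`). [cite: Zhang2022LandauSiegel, §7 Prop 7.1 (7.2)] -/
theorem kbmulti_m3overhang_of_inRplus {θ : ℝ} {u u' v v' : ℝ → ℂ} {s : ℂ} (h : InRplus (.twoPiece θ u u' v v' s)) :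
    KBmulti (.m3overhang θ u u' v v' s) :=
  ⟨h.1, h.2.1, h.2.2.rough⟩

/-- EMBEDDING: an in-class piece of `R⁺` (wall value `0`) with any band datum is an `m3wall` member.
[cite: Zhang2022LandauSiegel, §7 Prop 7.1 (7.2)] -/
theorem kbmulti_m3wall_of_inClassPiece {u u' : ℝ → ℂ} (hu : InClassPiece u u') (W : WallData) :
    KBmulti (.m3wall u u' W) :=
  hu.kinked

/-- EMBEDDING: a one-sided `R̄` pair (both profiles kinked with wall value `0`) is an `m0` member.
[cite: Zhang2022LandauSiegel, §2 (2.32)–(2.33)] -/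
theorem kbmulti_m0_of_kinked {g g' f f' : ℝ → ℂ} (hg : KinkedProfile g g') (hf : KinkedProfile f f') (hg1 : g 1 = 0)
    (hf1 : f 1 = 0) : KBmulti (.m0 g g' f f') :=
  ⟨hg.isH1, hf.isH1, hg1, hf1⟩

/-! ### Part 4 — C4: the class is inhabited, sub-class by sub-class, by the word's own designs -/

section Witnesses

/-- The smooth formula behind `ϰ` (copy of the private lemma of `RepairKappaProfile`). [cite: Zhang2022LandauSiegel, (2.23)–(2.25)] -/
private theorem hasDerivAt_kappaFormula' {ν k : ℝ} (hν : ν ≠ 0) (x : ℝ) :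
    HasDerivAt (fun y : ℝ => (((1 - y / ν : ℝ)) : ℂ) * cexp ((k : ℂ) * π * I * ((ν - y : ℝ) : ℂ)))
      (-(((1 / ν : ℝ)) : ℂ) * ((1 + (k : ℂ) * π * I * ((ν - x : ℝ) : ℂ))
        * cexp ((k : ℂ) * π * I * ((ν - x : ℝ) : ℂ)))) x := by
  have hν' : (ν : ℂ) ≠ 0 := by exact_mod_cast hν
  have h1 : HasDerivAt (fun y : ℝ => ((ν - y : ℝ) : ℂ)) (-1) x := by
    have := ((hasDerivAt_id x).const_sub ν).ofReal_comp
    simpa using this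
  have h2 : HasDerivAt (fun y : ℝ => (((1 - y / ν : ℝ)) : ℂ)) (-(1 / ν : ℂ)) x := by
    have := (((hasDerivAt_id x).div_const ν).const_sub 1).ofReal_comp
    simpa using this
  have hE : HasDerivAt (fun y : ℝ => cexp ((k : ℂ) * π * I * ((ν - y : ℝ) : ℂ)))
      (cexp ((k : ℂ) * π * I * ((ν - x : ℝ) : ℂ)) * ((k : ℂ) * π * I * (-1))) x :=
    (h1.const_mul ((k : ℂ) * π * I)).cexp
  refine (h2.mul hE).congr_deriv ?_
  push_cast
  field_simp
  ring

/-- **A LONG Zhang piece truncated at the wall is a kinked bulk with FREE wall value:** for `ν > 1`, `ϰ_{ν,k}`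
restricted to `[0,1]` is a `KinkedProfile` (no kink inside `[0,1]`; derivative bounded by `(1/ν)(1 + |k|πν)`).
This is the bulk of design multi-wall-002 (`ν = 21/20`, `k = 5/2`), with `ϰ(1) ≠ 0` (`kappaP_one_ne_zero`).
[cite: Zhang2022LandauSiegel, (2.23)–(2.25)] -/
theorem kinkedProfile_kappaP_long {ν k : ℝ} (hν : 1 < ν) : KinkedProfile (kappaP ν k) (kappaP' ν k) where
  cont := by
    have hform : Continuous fun y : ℝ =>
        (((1 - y / ν : ℝ)) : ℂ) * cexp ((k : ℂ) * π * I * ((ν - y : ℝ) : ℂ)) := by fun_prop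
    refine (hform.continuousOn (s := Icc 0 1)).congr fun y hy => ?_
    exact kappaP_of_le (hy.2.trans hν.le)
  hasDeriv := by
    intro x hx
    have hxν : x < ν := hx.2.trans hν
    have hd := hasDerivAt_kappaFormula' (k := k) (by linarith : ν ≠ 0) x
    have heq : ∀ᶠ y in nhds x, kappaP ν k y
        = (((1 - y / ν : ℝ)) : ℂ) * cexp ((k : ℂ) * π * I * ((ν - y : ℝ) : ℂ)) := by
      filter_upwards [Iio_mem_nhds hxν] with y hy using kappaP_of_le (le_of_lt hy)
    rw [kappaP'_of_lt hxν]
    exact (hd.congr_of_eventuallyEq heq).hasDerivWithinAt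
  memLp := by
    have h0 : 0 < ν := by linarith
    have hform : Continuous fun y : ℝ => -(((1 / ν : ℝ)) : ℂ) * ((1 + (k : ℂ) * π * I * ((ν - y : ℝ) : ℂ))
        * cexp ((k : ℂ) * π * I * ((ν - y : ℝ) : ℂ))) := by fun_prop
    have hmeas : AEStronglyMeasurable (kappaP' ν k) (volume.restrict (Ioc (0:ℝ) 1)) := by
      refine (hform.aestronglyMeasurable.restrict).congr ?_
      filter_upwards [ae_restrict_mem measurableSet_Ioc] with y hy
      exact (kappaP'_of_lt (hy.2.trans_lt hν)).symm
    refine MemLp.of_bound hmeas (1 / ν * (1 + |k| * π * ν)) ?_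
    filter_upwards [ae_restrict_mem measurableSet_Ioc] with y hy
    have hyν : y < ν := hy.2.trans_lt hν
    rw [kappaP'_of_lt hyν]
    have hw0 : 0 ≤ ν - y := by linarith
    have hw1 : ν - y ≤ ν := by linarith [hy.1]
    rw [norm_mul, norm_neg, norm_mul, Complex.norm_real, Complex.norm_exp]
    have hre : ((k : ℂ) * π * I * ((ν - y : ℝ) : ℂ)).re = 0 := by
      simp [Complex.mul_re, Complex.mul_im]
    rw [hre, Real.exp_zero, mul_one, Real.norm_eq_abs, abs_of_pos (one_div_pos.2 h0)]
    refine mul_le_mul_of_nonneg_left ?_ (one_div_pos.2 h0).le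
    calc ‖(1 : ℂ) + (k : ℂ) * π * I * ((ν - y : ℝ) : ℂ)‖
        ≤ ‖(1 : ℂ)‖ + ‖(k : ℂ) * π * I * ((ν - y : ℝ) : ℂ)‖ := norm_add_le _ _
      _ = 1 + |k| * π * (ν - y) := by
          rw [norm_one, norm_mul, norm_mul, norm_mul, Complex.norm_I, mul_one, Complex.norm_real,
            Complex.norm_real, Complex.norm_real, Real.norm_eq_abs, Real.norm_eq_abs, Real.norm_eq_abs,
            abs_of_pos Real.pi_pos, abs_of_nonneg hw0]
      _ ≤ 1 + |k| * π * ν := by gcongr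

/-- … and its wall value is NOT zero: `‖ϰ_{ν,k}(1)‖ = 1 − 1/ν > 0` for `ν > 1`.
[cite: Zhang2022LandauSiegel, (2.23)–(2.25)] -/
theorem kappaP_one_ne_zero {ν k : ℝ} (hν : 1 < ν) : kappaP ν k 1 ≠ 0 := by
  rw [kappaP_of_le hν.le]
  refine mul_ne_zero ?_ (Complex.exp_ne_zero _)
  have : (0 : ℝ) < 1 - 1 / ν := by
    have h0 : 0 < ν := by linarith
    rw [sub_pos, div_lt_one h0]; exact hν
  exact_mod_cast this.ne'

/-- **C4 (M3-wall), the word's member multi-wall-002 (literal reading):** Zhang's own `H₁₂`-piece `ϰ(21/20, 5/2)`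
truncated at the wall (bulk with wall value `ϰ(1) ≠ 0`) continued FLAT through the band at that height is an
`m3wall` member. [cite: Zhang2022LandauSiegel, (2.23)–(2.25); §2 (2.30)] -/
theorem inClass_wall002 :
    KBmulti (.m3wall (kappaP (21/20) (5/2)) (kappaP' (21/20) (5/2)) (WallData.flat (kappaP (21/20) (5/2) 1)))
    ∧ kappaP (21/20) (5/2) 1 ≠ 0 :=
  ⟨kinkedProfile_kappaP_long (by norm_num), kappaP_one_ne_zero (by norm_num)⟩

/-- … and its verdict of record (by `familyBmulti_decided`): in every world with `K ≥ 0` and a subordinate cross term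
the model constant of multi-wall-002 is not negative. [cite: Zhang2022LandauSiegel, §7 Prop 7.1 (7.2), §8 Lemma 8.1] -/
theorem verdict_wall002 :
    VBmulti (.m3wall (kappaP (21/20) (5/2)) (kappaP' (21/20) (5/2)) (WallData.flat (kappaP (21/20) (5/2) 1))) :=
  familyBmulti_decided
    (BmultiDesign.m3wall (kappaP (21/20) (5/2)) (kappaP' (21/20) (5/2)) (WallData.flat (kappaP (21/20) (5/2) 1)))
    inClass_wall002.1

/-- **C4 (M3-wall), constant bulk with wall value `1`** (p459421's witness) and **(M1) the BPRZ-type interior step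
`g⋆ + 𝟙_[0,1/2)`** (p4's `jumpStar`, any kernel) and **(M3-overhang) `g⋆ ⊕ 𝟙_[1,θ)`** (p457552's plateau, `θ ≥ 1`)
and **(M4) the printed `θ₀`** and **(M0) the kernel mode `g⋆`** are members. [cite: Zhang2022LandauSiegel, §7 Prop 7.1 (7.2)] -/
theorem kbmulti_inhabited {θ : ℝ} (hθ : 1 ≤ θ) (κ : ℝ → ℝ) (s : ℂ) :
    KBmulti (.m3wall (fun _ => (1:ℂ)) (fun _ => (0:ℂ)) (WallData.flat 1)) ∧
      KBmulti (.m1 κ jumpStar) ∧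
      KBmulti (.m3overhang θ gStar gStar' (plateau θ) (fun _ => 0) s) ∧
      KBmulti (.m4 theta0) ∧
      KBmulti (.m0 gStar gStar' gStar gStar') :=
  ⟨kinkedProfile_constOne, admissible_jumpStar, familyRoughTwoPiece_inClass_gStar_plateau hθ s,
    admissible_theta0.lengthsInUnit,
    ⟨inClassPiece_gStar.kinked.isH1, inClassPiece_gStar.kinked.isH1, inClassPiece_gStar.vanish 1 le_rfl,
      inClassPiece_gStar.vanish 1 le_rfl⟩⟩

end Witnesses

/-! ### Part 5 — the slots of the word are inhabited and load-bearing (pointers to the landed exhibits) -/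

/-- **Slots inhabited / load-bearing, by sub-class (citations, one term each):** M1 — kernel `≡ 0` satisfies the
slot and `KnifeEdge.JumpCloses (fun _ => −1)` (p4's `jumpCloses_neg_one`); M3-wall — `exists_slots_wallBand` and
`familyWallBand_unslotted_fails` (p459723); M3-overhang — `exists_slots_rough` and `not_nullOn_rough_zero`
(p459028 / p457552). Packaged: each sub-class has a world satisfying its slots.
[cite: Zhang2022LandauSiegel, §7 Prop 7.1 (7.2), §8 Lemma 8.1] -/
theorem bmulti_slots_inhabited (θ : ℝ) :
    (∃ κ : ℝ → ℝ, ∀ z ∈ Ioo (0:ℝ) 1, 0 ≤ κ z) ∧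
      (∃ (K : (ℝ → ℂ) → ℝ) (X : WallCross), (∀ b : ℝ → ℂ, 0 ≤ K b) ∧ WallCrossCS K X) ∧
      (∃ X : PairFunctional, BandNonnegOn (RoughOverhangPiece θ) θ X ∧ CrossSubordinateOn (RoughOverhangPiece θ) θ X) :=
  ⟨⟨fun _ => 0, fun _ _ => le_rfl⟩, exists_slots_wallBand, exists_slots_rough θ⟩

/-- **… and load-bearing**: deleting the slot makes each model verdict fail on a member — M1 (`jumpCloses_neg_one`),
M3-wall (`eMultiBandCloses_exhibit`), M3-overhang in the world `X = 0` for `θ > 1` (`rough_closesByPositivity_zero`).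
[cite: Zhang2022LandauSiegel, §7 Prop 7.1 (7.2), §8 Lemma 8.1] -/
theorem bmulti_slots_loadBearing {θ : ℝ} (hθ : 1 < θ) :
    JumpCloses (fun _ => -1) ∧ EMultiBandCloses bandK crossNegWorld ∧
      ClosesByPositivityOn (RoughOverhangPiece θ) θ 0 :=
  ⟨jumpCloses_neg_one, eMultiBandCloses_exhibit, rough_closesByPositivity_zero hθ⟩

/-! ### Part 6 — Intake record v1.1 (C1 amendment of record; decls of Parts 1–5 unchanged)

**Text of record for C1 (supersedes the module docstring's «KILL-CERT v2.1» pointer).** By director-frontier's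
AMENDMENT 2026-08-26T18:15:06Z (on ls-ref-1's correction 18:13:05Z, adopted in full) the WORD STANDS (KILL,
candidates 0, no number load-bearing) but its PREMISE OF RECORD is **B-AH / registry E-014** — the model-expectation
identity «displayed main terms on the span = lattice-model expectations, PSD BY CONSTRUCTION», status «derivation»,
heuristic of record — and NOT «a limit of PSD forms is PSD» from Prop 7.1: both discrete statements are deductions
under (A) and cannot by themselves make an indefinite block a defect. The KILL is OF RECORD as **«KILL inside `K_multi`
GIVEN B-AH (E-014)»**; sentence of record = KILL-CERT v2.2 (HOME/B-multi/KILL-draft.md sha16 09119f7aef1550b3) §1,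
re-worded in v2.3 exactly as ls-ref-1 proposed: «…each such negation contradicts B-AH (E-014)…; an indefinite
correctly-derived block would be a main-order (c)-exhibit = ¬(A)-content, used in no word until the non-model step
is named, theory-reviewed and kernel-checked; none exists and B-AH predicts none». Member-level join of record:
HOME/B-multi/INTAKE-COVERAGE.md v1.1 (ls-Bmulti-plan, §0 word verbatim, §1 twelve members ↦ sub-class ↦ family ↦
currency ↦ slot ↦ discharge, §2 precisions (i)–(iii) — all three followed by Parts 1–4 above —, §3 exits).

**Currency / slot-kind / flag table (REF-E §0b-v4).** «Every displayed slot a LANDED theorem» in the word refers to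
the WORLD slots (binders over a world parameter, each inhabited ∧ load-bearing by a landed term); the ANALYTIC content
(that the model constant IS the (A)-world main term: rows E-028 / E-034 / E-006 / E-030 as dictionary claims) is
CONDITIONAL on B-AH (E-014) and is no theorem of the tree.

| constructor | currency | WORLD slot(s) (binder; inhabited ∧ load-bearing by) | ANALYTIC E-row behind it (status) | flag |
|---|---|---|---|---|
| `m0` | 𝔅 / polar CS, (4.1) identity region (`g(1) = f(1) = 0` in the class) | none | none (Prop 7.1 region) | decided (E-017 «validity off R» as text only off class R) |
| `m1 κ J` | MODEL main term `jumpMainTerm κ J` (balanced reading) | `∀ z ∈ (0,1), 0 ≤ κ z` — inhabited (`κ ≡ 0`), load-bearing (`Repair.jumpCloses_neg_one`, p460685) | E-028 (derivation; `κ` closed form not derived, INERT) | model · conditional on B-AH · LITERAL fixed-height reading UNCOVERED |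
| `m3wall u u' W` | MODEL main term `wallMainTerm K X u u' W` | `∀ b, 0 ≤ K b` (discharged for `bandK`: `bandK_nonneg`) ∧ `WallCrossCS K X` — inhabited (`exists_slots_wallBand`), load-bearing (`eMultiBandCloses_exhibit`, p459723); forced by the dictionary unless (A) eventually false (`wallCrossCS_of_dictionary`, p460888) | E-034 (HEURISTIC derivation), E-006 (open-in-print-adjacent; discrete CS a THEOREM p459102); bulk entry at `u(1⁻) ≠ 0` = (4.1) MODEL, Q→theory-3 open | model · conditional on B-AH · LITERAL amplitude reading UNCOVERED |
| `m3overhang θ u u' v v' s` | `X`-world (continued blocks + off-diagonal `X`) | `BandNonnegOn` ∧ `CrossSubordinateOn` — inhabited (`exists_slots_rough`), load-bearing (`not_crossSubordinateOn_rough_zero`, p457552/p459028) | E-005/E-006 objects; continued calculus off `R`: E-017/E-002 open | X-world · conditional · validity off R open |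
| `m4 θ` | continued calculus, T-true (`C232S·C233T` vs `‖dSumS‖²`) | none | none on `R`; engine-class flag beyond `AdmissibleTheta` (E-017 text) | decided |
| (v2) M2, MIXED, far-BV | MODEL / discrete | `LambdaDiagNonneg ∧ LambdaBlockCS`; Gram PSD; none | E-030 (INERT); per-pair dictionary; E-033 THEOREM | pending p5 / p2 / p4 |

**UNCOVERED sub-words (no theorem of the tree says «no» there; the word does not claim them either):** (u1) the
LITERAL (fixed-amplitude) readings of M1 and M3 — a fixed jump height or wall value enters at the trivial scale and the
model constants above are the BALANCED readings only (KILL-CERT §2 «amplitude reading ∈ {literal, balanced}»: the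
literal reading «diverges unless h → 0», E-005 docstring of p458037; exit x3 «unbalanced band = E*-len literal»);
(u2) the (c)-door of FEASIBILITY §0 (F2) — «exhibit a correctly-derived indefinite main-order block» — logged as an
OPEN registry row by the director's (2), owner §D/§E, B-AH predicts none; (u3) the EXITS x1 (coefficient mass beyond the
dual length in the `X`-world, E-001/E-002 → B-len; R⁺⁺ row «lengths ≥ P with general coefficients» UNCOVERED, p459189 is
a non-covering threshold), x2 (`μψ` / E-032-class pieces → §E p2), x3 (unbalanced band). Nothing in this file bears on
(u1)–(u3). FRAMING: the programme SEARCHES and TYPES; no claim about Landau–Siegel zeros, Theorems 1–2 of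
arXiv:2211.02515 or a repaired Margin232 until a kernel theorem says so. -/

/-- **Guard G1, enforced by the class** (COVERAGE.md; INTAKE-COVERAGE §2): a bulk with a nonzero LEFT wall value
(multi-wall-002-type, `g(1) ≠ 0`) is NOT an `m0` member — it enters `K_multi` only through `m3wall` (model currency),
never through the 𝔅-currency family `familyH1`. [cite: Zhang2022LandauSiegel, §7 Prop 7.1 (7.2)] -/
theorem not_kbmulti_m0_of_wall_ne_zero {g g' f f' : ℝ → ℂ} (h : g 1 ≠ 0) : ¬ KBmulti (.m0 g g' f f') :=
  fun hk => h hk.2.2.1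

/-- … in particular Zhang's truncated long piece `ϰ(21/20, 5/2)∣[0,1]` (wall value `≠ 0`, `kappaP_one_ne_zero`) is an
`m3wall` member (`inClass_wall002`) and NOT an `m0` member, with any probe. [cite: Zhang2022LandauSiegel, (2.23)–(2.25)] -/
theorem wall002_not_m0 (f f' : ℝ → ℂ) :
    ¬ KBmulti (.m0 (kappaP (21/20) (5/2)) (kappaP' (21/20) (5/2)) f f') :=
  not_kbmulti_m0_of_wall_ne_zero (kappaP_one_ne_zero (by norm_num))

/-! ### Part 7 — Intake record v1.2: the certificate of record QUOTED (C1), and the list v2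

**THE CERTIFICATE TO QUOTE VERBATIM (ls-Bmulti-plan RE-ISSUE LINE 18:43:59Z; REF-E §0b-v4 I1 as amended) is
KILL-CERT v2.4, HOME/B-multi/KILL-draft.md sha16 96c2304f42278a63 (FROZEN), §1** — superseding the v2.1/v2.2 pointers
of the module docstring and of Part 6 (v2.2 predates the director's 18:15:06Z amendment and still carried the rejected
«limit of PSD ⇒ defect» sentence; §2 class text is byte-identical since v1.4, so every §2-based row of Parts 1–6
stands). §1 verbatim (typography: a space is inserted after each slash that precedes a hyphen in the member ids,
to keep this Lean comment well-formed; nothing else changed):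

> «KILL(B-multi) inside K_multi GIVEN B-AH (E-014): no design d of the class K_multi = (L-a) ∪ (L-b) of §2 closes Zhang's criterion at MAIN ORDER in the currency of §5: every term any member displays — bulk (4.1) form of each H¹ block, interior-jump term (E-028), band term V = |c|²K[b] (E-005/E-034), bulk×band cross (E-006), Λ-class block (E-030) — is an entry of ONE Hermitian main-term matrix G_d on the finite span of d's pieces, read off the discrete form Σ_ρ 𝔠*ω|H_d(ρ)|² (non-negative weights and the dictionary asymptotic BOTH being deductions under (A) — Lemma 2.3 / Prop 7.1 — so «(A) ⇒ G_d ⪰ 0» is NOT the premise of this word: read contrapositively it is Zhang's closing itself; ls-ref-1 18:13:05Z) in THREE spans with three statuses (W-2): bulk n < P·T⁻² = Prop 7.1's MODEL (the (4.1) form, theorem-level in the tree: `mainTermForm_nonneg_of_isH1`); band / jump / cross / Λ terms on P·T⁻² < n ≤ P^{1+ε₀} (and the prime-supported pieces) = DISPLAYED SLOTS (derivations E-028 / E-034 / E-006 / E-030, typed p458438 / p458037 / p459102 / p459168); far n > P^{1+ε₀} = THEOREM (E-033: tailInvisible_bv p457577 + discMeanFlat_bv p457806, any bounded-variation far structure);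 hence OBJ(d) = xᵀG_d x ≥ 0 at main order for every d ∈ K_multi GIVEN the displayed slot GramPSD(G_d) — whose 1- and 2-block instances are JumpKernelPos (E-028), bandK ≥ 0 (E-034, PROVED) ∧ WallCrossCS (E-006), LambdaBlock-CS (E-030) — and GramPSD is exactly what B-AH / E-014 predicts (MODEL-EXPECTATION IDENTITY, heuristic of record, status «derivation»: every displayed entry derived inside the wall by the dictionary equals the LATTICE-MODEL expectation, and the model is an actual non-negative-weight configuration, so G_d = model Gram ⪰ 0 BY CONSTRUCTION; its bulk instance `mainTermForm_nonneg_of_isH1` and its band-diagonal instance `bandK_nonneg` are THEOREMS); closing would require the NEGATION of a displayed slot at main order — E-035 (cross beyond CS-saturation, κ > 2; priced XL, «(B1)-excluded at main order»: the (bulk, band) block of the model Gram is PSD) or an indefinite Λ-block (E-030) — and each such negation contradicts B-AH (E-014: main terms on the span = model expectations, PSD by construction); an indefinite CORRECTLY-derived block would be a main-order non-model exhibit = ¬(A)-content (ls-ref-1's case (c): logically possible — it is what a main-order closing certificate would look like — excluded by B-AH, not by Prop 7.1; logged as the named open door EDREGISTRY v1.27 row E-085 «non-model main-order entry», status none known,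 owner §D/§E, director AMENDMENT 18:15:06Z (2)), which the cell uses in no word until the non-model step is named, theory-reviewed and kernel-checked; none exists and B-AH predicts none (FEASIBILITY §0 (F2)'s escape clause stays on the record); the only genuine routes to OBJ < 0 put coefficient mass beyond the dual length with non-cancelling coefficients (exits x1–x3 of §8) = an input of E*-len strength. Members certified: multi-sanity-001/ -002, multi-jump-001/ -002/ -003, multi-wall-001/ -002/ -003/ -004, multi-lambda-001/ -002, multi-far-001 (BATCH-1.json e90899402ce766c5, INDEX.md 911de77af66e265d), DESIGN-MAP-multi.md v1.0 dd3090700232dde8; numbers three-lineage A ls-Bmulti-num-1 j257024 (+ j257271 completion, j257329 labels) × A3-exact ls-num-1 j257300 × B ls-Bmulti-num-2 j257108 (= j256526; + j257326 H¹-part), pair tables f5f8c58efe4af446 (170/0), dffbffe862037ce7 (111 + 15/15; 5 naming-only), 548fea540c0d7739 (203), 0 numeric disagreements; ref-num PASS two-lineage 170/170, custody CLOSED (ls-ref-num 18:01:06Z, AUDIT-LEDGER l.1846–2015; the 71 PASS-pre of l.564–639 lifted, M3 completion block 61/61 PASS, 5 far-001 label cells resolved by the naming ruling) (no number load-bearing: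 decided rows are theorems, slot rows are «no given <landed slot>»); displayed slots LANDED: E-028 p458438 (bfdfcb7c77d5: `not_jumpCloses_of_jumpKernelPos`), E-005/E-034/E-035 p458037 (7dbcb6f5d597: `not_eMultiBandCloses_of_cs`, `eMultiBandCloses_of_crossNeg`), E-006/E-035-discrete p459102 (40bb6e7ba37f: `norm_sq_discPolar_le`, `theorem1_of_crossNegDiscrete`), E-030 p459168 (1e9e76324d9c: `not_eMultiLambdaCloses_of_cs`, `eMultiLambdaCloses_of_indefinite`), E-033 p457384/p457577/p457806 (`tailInvisible_bv`, `discMeanFlat_bv`); §E already holds M3 as `KnifeEdge.familyWallBand_decided` p459421 (01217803a8d3).»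

**The list, v2** (`bmultiWord2`, planner SHAPE NOTE 18:25:26Z: every member a CLOSED `DesignFamily` term): v1 ++ the two
further LANDED families the note names — `Repair.familyR` (class `R` itself, p455670; ⊆ `familyRLengths` by
`AdmissibleTheta.lengthsInUnit`, kept for the record) and `Repair.familyTwoPieceJoint` (p457753: the smooth two-piece
design with the in-class probe, JOINT currency `¬ (q_X(s)·𝔅(f) < |cross|²)` under the displayed slot
`InvisibleOverhang θ X`). The sum type gains the constructor `m3joint` (`BmultiDesign2`, `familyBmulti2`, decided).
STILL PENDING (v3): `familyLambdaBlockAll` (M2, p5 g2 S-E-p5-3), `familyGramBlockAll` (MIXED, ls-Bmulti-typer-1 g2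
S-E-t1-1 / p2), `familyFarBV` ((L-a.iii), p4 S-E-p4-4). FRAMING: the programme SEARCHES and TYPES; no claim about
Landau–Siegel zeros, Theorems 1–2 of arXiv:2211.02515 or a repaired Margin232 until a kernel theorem says so. -/

/-- **The word's families, v2** = v1 ++ `[familyR, familyTwoPieceJoint]` (both landed, p455670 / p457753).
[cite: Zhang2022LandauSiegel, §2 (2.32)–(2.33); §7 Prop 7.1 (7.2)] -/
def bmultiWord2 : List DesignFamily := bmultiWord ++ [familyR, familyTwoPieceJoint]

/-- **v2 is decided** (`bmultiWord_decided`, `not_repairable_true_need`, `familyTwoPieceJoint_decided`).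
[cite: Zhang2022LandauSiegel, §2 (2.32)–(2.33); §7 Prop 7.1 (7.2)] -/
theorem bmultiWord2_decided : ClassDecided bmultiWord2 :=
  classDecided_append.2 ⟨bmultiWord_decided,
    classDecided_cons (fun θ h => not_repairable_true_need θ h) <|
      classDecided_cons familyTwoPieceJoint_decided classDecided_nil⟩

/-- `R⁺ ++ bmultiWord2` is decided. [cite: Zhang2022LandauSiegel, §2 (2.32)–(2.33)] -/
theorem rplus_bmultiWord2_decided : ClassDecided (Rplus ++ bmultiWord2) :=
  classDecided_append.2 ⟨rplus_decided, bmultiWord2_decided⟩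

/-- v1 is a prefix of v2 (nothing dropped). [cite: Zhang2022LandauSiegel, §2 (2.32)–(2.33)] -/
theorem bmultiWord_sub_bmultiWord2 : ∀ F ∈ bmultiWord, F ∈ bmultiWord2 :=
  fun _ hF => List.mem_append.2 (Or.inl hF)

/-- **Designs of `K_multi`, v2**: v1's five constructors (embedded by `ofV1`) plus `m3joint` = the smooth two-piece
design WITH its in-class probe (`Repair.JointDesign` of p457753), JOINT currency.
[cite: Zhang2022LandauSiegel, §2 (2.32)–(2.33); §7 Prop 7.1 (7.2)] -/
inductive BmultiDesign2 : Type
  | ofV1 (d : BmultiDesign)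
  | m3joint (d : JointDesign)

/-- Membership, v2: as v1 on `ofV1`; `familyTwoPieceJoint.InClass` on `m3joint` (`1 ≤ θ`, `u`, `f` in class, `v` a smooth
overhang). [cite: Zhang2022LandauSiegel, §2 (2.32)–(2.33); §7 Prop 7.1 (7.2)] -/
def KBmulti2 : BmultiDesign2 → Prop
  | .ofV1 d => KBmulti d
  | .m3joint d => familyTwoPieceJoint.InClass d

/-- Verdict, v2: as v1 on `ofV1`; on `m3joint` the JOINT-currency verdict of p457753 with its displayed slot
`InvisibleOverhang θ X`. [cite: Zhang2022LandauSiegel, §2 (2.32)–(2.33); §7 Prop 7.1 (7.2)] -/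
def VBmulti2 : BmultiDesign2 → Prop
  | .ofV1 d => VBmulti d
  | .m3joint d => familyTwoPieceJoint.Verdict d

/-- **`K_multi` as one family, v2.** [cite: Zhang2022LandauSiegel, §2 (2.32)–(2.33); §7 Prop 7.1 (7.2)] -/
def familyBmulti2 : DesignFamily where
  Design := BmultiDesign2
  InClass := KBmulti2
  Verdict := VBmulti2

/-- **v2 is decided** (v1 by `familyBmulti_decided`; `m3joint` by `familyTwoPieceJoint_decided`).
[cite: Zhang2022LandauSiegel, §2 (2.32)–(2.33); §7 Prop 7.1 (7.2)] -/
theorem familyBmulti2_decided : familyBmulti2.Decided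
  | .ofV1 d, h => familyBmulti_decided d h
  | .m3joint d, h => familyTwoPieceJoint_decided d h

/-- `R⁺ ++ [K_multi v2]` is decided. [cite: Zhang2022LandauSiegel, §2 (2.32)–(2.33)] -/
theorem rplus_bmulti2_decided : ClassDecided (Rplus ++ [familyBmulti2]) :=
  rplus_extend familyBmulti2_decided

/-- v1 embeds into v2 with class and verdict unchanged (by `Iff.rfl`). [cite: Zhang2022LandauSiegel, §2 (2.32)–(2.33)] -/
theorem kbmulti2_ofV1_iff (d : BmultiDesign) :
    (KBmulti2 (.ofV1 d) ↔ KBmulti d) ∧ (VBmulti2 (.ofV1 d) ↔ VBmulti d) :=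
  ⟨Iff.rfl, Iff.rfl⟩

/-- C4 for `m3joint`: `g⋆ ⊕ φ_θ` with probe `g⋆` is a member for every `θ ≥ 1` (p457753's witness).
[cite: Zhang2022LandauSiegel, §7 Prop 7.1 (7.2)] -/
theorem kbmulti2_m3joint_star {θ : ℝ} (hθ : 1 ≤ θ) (s : ℂ) :
    KBmulti2 (.m3joint ⟨θ, gStar, gStar', phiT θ, phiT' θ, s, gStar, gStar'⟩) :=
  familyTwoPieceJoint_inClass_star hθ s

/-! ### Part 8 — the list v3: the multi-scalar M3-overhang families (E-12, p461544) join

`KnifeEdge.familyRoughThreePiece` (two in-class pieces with independent scalars ⊕ one rough overhang, POS currency) and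
`KnifeEdge.familyRoughTwoPieceJoint` (rough two-piece against an in-class probe, JOINT currency, with the displayed
consistency slot `WorldLinearOn` and the slots E-005/E-006) — KnifeEdgeThreePiece.lean, p461544, ls-barrier-p1 (E-12)
— are the «(m+1)-pencil» members of sub-class M3-overhang the planner asked to list (18:54:46Z). Text of record for
C1 unchanged: KILL-CERT v2.4 96c2304f42278a63 §1 (Part 7), premise B-AH (E-014). STILL PENDING (next version):
`familyLambdaBlockAll` (M2), `familyGramBlockAll` (MIXED), `familyFarBV` ((L-a.iii)). FRAMING: the programme SEARCHES
and TYPES; no claim about Landau–Siegel zeros, Theorems 1–2 of arXiv:2211.02515 or a repaired Margin232 until a kernel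
theorem says so. -/

/-- **The word's families, v3** = v2 ++ `[familyRoughThreePiece, familyRoughTwoPieceJoint]` (p461544).
[cite: Zhang2022LandauSiegel, §2 (2.32)–(2.33); §7 Prop 7.1 (7.2)] -/
def bmultiWord3 : List DesignFamily := bmultiWord2 ++ [familyRoughThreePiece, familyRoughTwoPieceJoint]

/-- **v3 is decided** (`bmultiWord2_decided`, `familyRoughThreePiece_decided`, `familyRoughTwoPieceJoint_decided`).
[cite: Zhang2022LandauSiegel, §2 (2.32)–(2.33); §7 Prop 7.1 (7.2)] -/
theorem bmultiWord3_decided : ClassDecided bmultiWord3 :=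
  classDecided_append.2 ⟨bmultiWord2_decided,
    classDecided_cons familyRoughThreePiece_decided <|
      classDecided_cons familyRoughTwoPieceJoint_decided classDecided_nil⟩

/-- `R⁺ ++ bmultiWord3` is decided. [cite: Zhang2022LandauSiegel, §2 (2.32)–(2.33)] -/
theorem rplus_bmultiWord3_decided : ClassDecided (Rplus ++ bmultiWord3) :=
  classDecided_append.2 ⟨rplus_decided, bmultiWord3_decided⟩

/-- v2 is a prefix of v3. [cite: Zhang2022LandauSiegel, §2 (2.32)–(2.33)] -/
theorem bmultiWord2_sub_bmultiWord3 : ∀ F ∈ bmultiWord2, F ∈ bmultiWord3 :=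
  fun _ hF => List.mem_append.2 (Or.inl hF)

/-- **Designs of `K_multi`, v3**: v2 plus `m3three` (two in-class pieces, independent scalars, one rough overhang:
`KnifeEdge.ThreePieceDesign`) and `m3roughJoint` (rough two-piece against an in-class probe: `Repair.JointDesign`).
[cite: Zhang2022LandauSiegel, §2 (2.32)–(2.33); §7 Prop 7.1 (7.2)] -/
inductive BmultiDesign3 : Type
  | ofV2 (d : BmultiDesign2)
  | m3three (d : ThreePieceDesign)
  | m3roughJoint (d : JointDesign)

/-- Membership, v3. [cite: Zhang2022LandauSiegel, §2 (2.32)–(2.33); §7 Prop 7.1 (7.2)] -/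
def KBmulti3 : BmultiDesign3 → Prop
  | .ofV2 d => KBmulti2 d
  | .m3three d => familyRoughThreePiece.InClass d
  | .m3roughJoint d => familyRoughTwoPieceJoint.InClass d

/-- Verdict, v3 (slots displayed inside the families' verdicts: `BandNonnegOn`, `CrossSubordinateOn`, and for the joint
currency the consistency slot `WorldLinearOn`). [cite: Zhang2022LandauSiegel, §2 (2.32)–(2.33); §7 Prop 7.1 (7.2)] -/
def VBmulti3 : BmultiDesign3 → Prop
  | .ofV2 d => VBmulti2 d
  | .m3three d => familyRoughThreePiece.Verdict d
  | .m3roughJoint d => familyRoughTwoPieceJoint.Verdict d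

/-- **`K_multi` as one family, v3.** [cite: Zhang2022LandauSiegel, §2 (2.32)–(2.33); §7 Prop 7.1 (7.2)] -/
def familyBmulti3 : DesignFamily where
  Design := BmultiDesign3
  InClass := KBmulti3
  Verdict := VBmulti3

/-- **v3 is decided.** [cite: Zhang2022LandauSiegel, §2 (2.32)–(2.33); §7 Prop 7.1 (7.2)] -/
theorem familyBmulti3_decided : familyBmulti3.Decided
  | .ofV2 d, h => familyBmulti2_decided d h
  | .m3three d, h => familyRoughThreePiece_decided d h
  | .m3roughJoint d, h => familyRoughTwoPieceJoint_decided d h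

/-- `R⁺ ++ [K_multi v3]` is decided. [cite: Zhang2022LandauSiegel, §2 (2.32)–(2.33)] -/
theorem rplus_bmulti3_decided : ClassDecided (Rplus ++ [familyBmulti3]) :=
  rplus_extend familyBmulti3_decided

/-- v2 embeds into v3 unchanged. [cite: Zhang2022LandauSiegel, §2 (2.32)–(2.33)] -/
theorem kbmulti3_ofV2_iff (d : BmultiDesign2) :
    (KBmulti3 (.ofV2 d) ↔ KBmulti2 d) ∧ (VBmulti3 (.ofV2 d) ↔ VBmulti2 d) :=
  ⟨Iff.rfl, Iff.rfl⟩

/-- C4 for the new constructors (p461544's witnesses): `s·g⋆ + t·ϰ_{1,5/2} ⊕ 𝟙_[1,θ)` and `s·g⋆ ⊕ 𝟙_[1,θ)` against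
`g⋆`, every `θ ≥ 1`. [cite: Zhang2022LandauSiegel, §7 Prop 7.1 (7.2)] -/
theorem kbmulti3_m3_witnesses {θ : ℝ} (hθ : 1 ≤ θ) (s t : ℂ) :
    KBmulti3 (.m3three ⟨θ, gStar, gStar', kappaP 1 (5/2), kappaP' 1 (5/2), plateau θ, fun _ => 0, s, t⟩) ∧
      KBmulti3 (.m3roughJoint ⟨θ, gStar, gStar', plateau θ, fun _ => 0, s, gStar, gStar'⟩) :=
  ⟨familyRoughThreePiece_inClass_witness hθ s t, familyRoughTwoPieceJoint_inClass_witness hθ s⟩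

/-! ### Part 9 — the list v4: (L-a.iii) far bounded-variation features join as a FAMILY (E-033 wrapped, p4)

`Repair.familyFarBV` (RepairFarBV.lean, ls-barrier-p4 S-E-p4-4; class = the E-033 hypotheses VERBATIM — sup `≤ B`,
total variation `≤ V` on `[1, 1+δ]`, `0 < ε < δ` —, verdict in the discrete-mean currency with the (A)-hypothesis
`Re ρ = ½` displayed, NO slot; decided by `tailInvisible_bv` / `discMeanFlat_bv`) is the covering family of sub-class
(L-a.iii); it supersedes the «theorem, not slot» text row of the v1 table. STILL PENDING (v5): `familyLambdaBlockAll`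
(M2), `familyGramBlockAll` (MIXED). Text of record for C1 unchanged (KILL-CERT v2.4 96c2304f42278a63 §1, B-AH). FRAMING:
the programme SEARCHES and TYPES; no claim about Landau–Siegel zeros, Theorems 1–2 of arXiv:2211.02515 or a repaired
Margin232 until a kernel theorem says so. -/

/-- **The word's families, v4** = v3 ++ `[familyFarBV]`. [cite: Zhang2022LandauSiegel, §2 (2.16)–(2.20), (2.32)–(2.33)] -/
def bmultiWord4 : List DesignFamily := bmultiWord3 ++ [familyFarBV]

/-- **v4 is decided** (`bmultiWord3_decided`, `familyFarBV_decided`). [cite: Zhang2022LandauSiegel, §2 (2.32)–(2.33)] -/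
theorem bmultiWord4_decided : ClassDecided bmultiWord4 :=
  classDecided_append.2 ⟨bmultiWord3_decided, classDecided_cons familyFarBV_decided classDecided_nil⟩

/-- `R⁺ ++ bmultiWord4` is decided. [cite: Zhang2022LandauSiegel, §2 (2.32)–(2.33)] -/
theorem rplus_bmultiWord4_decided : ClassDecided (Rplus ++ bmultiWord4) :=
  classDecided_append.2 ⟨rplus_decided, bmultiWord4_decided⟩

/-- v3 is a prefix of v4. [cite: Zhang2022LandauSiegel, §2 (2.32)–(2.33)] -/
theorem bmultiWord3_sub_bmultiWord4 : ∀ F ∈ bmultiWord3, F ∈ bmultiWord4 :=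
  fun _ hF => List.mem_append.2 (Or.inl hF)

/-- **Designs of `K_multi`, v4**: v3 plus `farBV` (`Repair.FarBVData` of p4's file).
[cite: Zhang2022LandauSiegel, §2 (2.16)–(2.20), (2.32)–(2.33)] -/
inductive BmultiDesign4 : Type
  | ofV3 (d : BmultiDesign3)
  | farBV (d : FarBVData)

/-- Membership, v4. [cite: Zhang2022LandauSiegel, §2 (2.32)–(2.33)] -/
def KBmulti4 : BmultiDesign4 → Prop
  | .ofV3 d => KBmulti3 d
  | .farBV d => familyFarBV.InClass d

/-- Verdict, v4 (`farBV`: discrete-mean currency, `Re ρ = ½` displayed, no slot).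
[cite: Zhang2022LandauSiegel, §2 (2.16)–(2.20), (2.32)–(2.33)] -/
def VBmulti4 : BmultiDesign4 → Prop
  | .ofV3 d => VBmulti3 d
  | .farBV d => familyFarBV.Verdict d

/-- **`K_multi` as one family, v4.** [cite: Zhang2022LandauSiegel, §2 (2.32)–(2.33)] -/
def familyBmulti4 : DesignFamily where
  Design := BmultiDesign4
  InClass := KBmulti4
  Verdict := VBmulti4

/-- **v4 is decided.** [cite: Zhang2022LandauSiegel, §2 (2.32)–(2.33)] -/
theorem familyBmulti4_decided : familyBmulti4.Decided
  | .ofV3 d, h => familyBmulti3_decided d h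
  | .farBV d, h => familyFarBV_decided d h

/-- `R⁺ ++ [K_multi v4]` is decided. [cite: Zhang2022LandauSiegel, §2 (2.32)–(2.33)] -/
theorem rplus_bmulti4_decided : ClassDecided (Rplus ++ [familyBmulti4]) :=
  rplus_extend familyBmulti4_decided

/-- v3 embeds into v4 unchanged. [cite: Zhang2022LandauSiegel, §2 (2.32)–(2.33)] -/
theorem kbmulti4_ofV3_iff (d : BmultiDesign3) :
    (KBmulti4 (.ofV3 d) ↔ KBmulti3 d) ∧ (VBmulti4 (.ofV3 d) ↔ VBmulti3 d) :=
  ⟨Iff.rfl, Iff.rfl⟩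

/-- C4 for `farBV` (p4's witnesses at the lengths of multi-far-001: a far step at `z = 3/2` and a far block on
`[3/2, 2)`, top `P²`, comparison length `P^{5/4}`). [cite: Zhang2022LandauSiegel, §2 (2.16)–(2.20)] -/
theorem kbmulti4_farBV_witnesses (c' : ℝ) :
    KBmulti4 (.farBV ⟨c', 1, 1 / 4, 1, 1, farStep⟩) ∧ KBmulti4 (.farBV ⟨c', 1, 1 / 4, 1, 2, farBlock⟩) :=
  ⟨inClass_farStep c' (by norm_num) (by norm_num), inClass_farBlock c' (by norm_num) (by norm_num)⟩

/-! ### Part 10 — the list v5: (L-b) M2, the Λ-type block family joins (p464018, ls-barrier-p5 g2)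

`Repair.familyLambdaBlockAll` (RepairLambdaBlock.lean, p464018, S-E-p5-3; designs `Repair.LambdaDesign` = in-class
`χψ`-bulk `u` with `u(1) = 0` ⊕ an admissible Λ-type piece `L` (`k ≥ 1`, `0 < ν ≤ 1`) at balanced amplitude `c`;
verdict = for EVERY model world `(K, X)` with the displayed slots `LambdaDiagNonneg K` (E-030, `K_Λ ≥ 0`) and
`LambdaBlockCS K X` (E-030 in (B1) form) the model constant `lambdaBlockMainTerm K X u u' L c` is not negative;
currency = (A)-world MODEL main term; E-030's closed forms INERT by price) covers sub-class M2 = (L-b) of the word.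
Declared delta (KILL-CERT §2 (L-b) says `k ∈ {1,2}`; `LambdaPiece.Admissible` asks `k ≥ 1` — wider, no member lost).
STILL PENDING (v6): `familyGramBlockAll` (MIXED). Text of record for C1 unchanged (KILL-CERT v2.4 96c2304f42278a63 §1,
B-AH (E-014)). FRAMING: the programme SEARCHES and TYPES; no claim about Landau–Siegel zeros, Theorems 1–2 of
arXiv:2211.02515 or a repaired Margin232 until a kernel theorem says so. -/

/-- **The word's families, v5** = v4 ++ `[familyLambdaBlockAll]`. [cite: Zhang2022LandauSiegel, §2 (2.32)–(2.33); §7 Prop 7.1 (7.2)] -/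
def bmultiWord5 : List DesignFamily := bmultiWord4 ++ [familyLambdaBlockAll]

/-- **v5 is decided** (`bmultiWord4_decided`, `familyLambdaBlockAll_decided`). [cite: Zhang2022LandauSiegel, §2 (2.32)–(2.33)] -/
theorem bmultiWord5_decided : ClassDecided bmultiWord5 :=
  classDecided_append.2 ⟨bmultiWord4_decided, classDecided_cons familyLambdaBlockAll_decided classDecided_nil⟩

/-- `R⁺ ++ bmultiWord5` is decided. [cite: Zhang2022LandauSiegel, §2 (2.32)–(2.33)] -/
theorem rplus_bmultiWord5_decided : ClassDecided (Rplus ++ bmultiWord5) :=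
  classDecided_append.2 ⟨rplus_decided, bmultiWord5_decided⟩

/-- v4 is a prefix of v5. [cite: Zhang2022LandauSiegel, §2 (2.32)–(2.33)] -/
theorem bmultiWord4_sub_bmultiWord5 : ∀ F ∈ bmultiWord4, F ∈ bmultiWord5 :=
  fun _ hF => List.mem_append.2 (Or.inl hF)

/-- **Designs of `K_multi`, v5**: v4 plus `m2` (`Repair.LambdaDesign`, sub-class M2).
[cite: Zhang2022LandauSiegel, §2 (2.32)–(2.33); §7 Prop 7.1 (7.2)] -/
inductive BmultiDesign5 : Type
  | ofV4 (d : BmultiDesign4)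
  | m2 (d : LambdaDesign)

/-- Membership, v5 (`m2`: `LambdaDesign.InClass` — kinked bulk with `u(1) = 0`, admissible Λ-piece).
[cite: Zhang2022LandauSiegel, §2 (2.32)–(2.33); §7 Prop 7.1 (7.2)] -/
def KBmulti5 : BmultiDesign5 → Prop
  | .ofV4 d => KBmulti4 d
  | .m2 d => familyLambdaBlockAll.InClass d

/-- Verdict, v5 (`m2`: ∀ worlds `(K, X)`, `LambdaDiagNonneg K → LambdaBlockCS K X → ¬ (lambdaBlockMainTerm … < 0)`).
[cite: Zhang2022LandauSiegel, §2 (2.32)–(2.33); §7 Prop 7.1 (7.2)] -/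
def VBmulti5 : BmultiDesign5 → Prop
  | .ofV4 d => VBmulti4 d
  | .m2 d => familyLambdaBlockAll.Verdict d

/-- **`K_multi` as one family, v5.** [cite: Zhang2022LandauSiegel, §2 (2.32)–(2.33)] -/
def familyBmulti5 : DesignFamily where
  Design := BmultiDesign5
  InClass := KBmulti5
  Verdict := VBmulti5

/-- **v5 is decided.** [cite: Zhang2022LandauSiegel, §2 (2.32)–(2.33)] -/
theorem familyBmulti5_decided : familyBmulti5.Decided
  | .ofV4 d, h => familyBmulti4_decided d h
  | .m2 d, h => familyLambdaBlockAll_decided d h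

/-- `R⁺ ++ [K_multi v5]` is decided. [cite: Zhang2022LandauSiegel, §2 (2.32)–(2.33)] -/
theorem rplus_bmulti5_decided : ClassDecided (Rplus ++ [familyBmulti5]) :=
  rplus_extend familyBmulti5_decided

/-- v4 embeds into v5 unchanged. [cite: Zhang2022LandauSiegel, §2 (2.32)–(2.33)] -/
theorem kbmulti5_ofV4_iff (d : BmultiDesign4) :
    (KBmulti5 (.ofV4 d) ↔ KBmulti4 d) ∧ (VBmulti5 (.ofV4 d) ↔ VBmulti4 d) :=
  ⟨Iff.rfl, Iff.rfl⟩

/-- C4 for `m2` (p5's witnesses = the word's members multi-lambda-001 and -002: Feng shapes `k = 1, 2` on the bulk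
`ϰ(63/125, 3/2)`, any balanced amplitude). [cite: Zhang2022LandauSiegel, §7 Prop 7.1 (7.2)] -/
theorem kbmulti5_m2_witnesses (c : ℂ) :
    KBmulti5 (.m2 (lambdaDesignFeng1 c)) ∧ KBmulti5 (.m2 (lambdaDesignFeng2 c)) :=
  inClass_lambdaDesignFeng c

/-! ### Part 11 — the list v6: the MIXED `k`-block members join (`KnifeEdge.familyGramBlockAll` p467185 +
`KnifeEdge.familyGramBlockDict` p468564, ls-Bmulti-typer-1 g2, RepairGramBlock.lean) — the word's last sub-class

Text of record for C1 unchanged (KILL-CERT v2.4 96c2304f42278a63 §1 «… mixed members included», premise B-AH (E-014)).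
MIXED members = `k` blocks at once: designs `KnifeEdge.GramDesign` = a list `piece : Fin k → KnifeEdge.MixedPiece` of
CONCRETE pieces (kinked `H¹` bulk, wall value free / `WallData` band / admissible `LambdaPiece` / interior step
`0 < z₀ < 1`) together with the member's MODEL MAIN-TERM MATRIX `gram` as a design coordinate (the p460685 shape);
class = every piece admissible (`KnifeEdge.GramDesign.InClass`), NO analytic hypothesis. TWO rows over the same
designs and class: `KnifeEdge.familyGramBlockAll` — MODEL currency, ONE displayed slot = the member matrix PSD (kind
(c)); pairwise Cauchy–Schwarz certificates are insufficient for `k ≥ 3` (`KnifeEdge.not_posSemidef_gramThree`: every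
`2 × 2` principal submatrix PSD yet `(1,1,1)` closes), hence the Gram slot; slot load-bearing
(`KnifeEdge.familyGramBlockAll_unslotted_fails`), discrete shadow a THEOREM (`KnifeEdge.familyGramTables`,
`KnifeEdge.discGram_pieces_posSemidef`); C2: the one-block families of the word are instances BY TERM
(`KnifeEdge.familyJumpBlockAll_decided_of_gram` M1, `KnifeEdge.familyLambdaBlockAll_decided_of_gram` M2,
`KnifeEdge.familyWallBand_decided_of_gram` M3-wall; on two blocks the slot IS the two-block certificate pair,
`KnifeEdge.posSemidef_two_iff`; on `1 + k` blocks it IS «second blocks jointly `⪰ 0` ∧ couplings jointly subordinate»,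
`KnifeEdge.posSemidef_bordered_iff`) — and `KnifeEdge.familyGramBlockDict` — the COVERAGE row (second eyes
ls-barrier-p2 g2 21:01:19Z): the dictionary `KnifeEdge.GramDictionary` of the pieces' REALISED TABLES displayed
(kind (c)) with Prop. 2.2 (i) / Lemma 2.3 (kind (b)) ⇒ «(A) eventually false ∨ no amplitude vector closes»
(`KnifeEdge.gramDictionary_dichotomy`) — CONDITIONAL reading, the pieces load-bearing. The constructor `mixed` carries
BOTH verdicts (conjunction). With v6 every sub-class named in KILL-CERT v2.4 96c2304f42278a63 §1/§2 (M0, M1, M2,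
M3-wall, M3-overhang (+ multi-scalar, + joint), M4, far-BV, MIXED) has a landed, decided family in the list; the
(c)-door E-085 («non-model main-order entry», director AMENDMENT 18:15:06Z (2); for MIXED members: a correctly-derived
indefinite model matrix — by `KnifeEdge.gramDictionary_dichotomy` such a dictionary is `¬(A)`-content outright) is used
in no word and stays on the record. p-id ledger of record: B-multi/INTAKE-COVERAGE.md v1.6 c79146d85eea9327 §6.
**UNCOVERED sub-words, VERBATIM from Parts 6/10 (no theorem of the tree says «no» there; the word does not claim them
either):** (u1) the LITERAL (fixed-amplitude) readings of M1 and M3 — a fixed jump height or wall value enters at the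
trivial scale and the model constants above are the BALANCED readings only (KILL-CERT §2 «amplitude reading ∈ {literal,
balanced}»: the literal reading «diverges unless h → 0», E-005 docstring of p458037; exit x3 «unbalanced band = E*-len
literal»); (u2) the (c)-door of FEASIBILITY §0 (F2) — «exhibit a correctly-derived indefinite main-order block» — logged
as an OPEN registry row by the director's (2), owner §D/§E, B-AH predicts none; (u3) the EXITS x1 (coefficient mass
beyond the dual length in the `X`-world, E-001/E-002 → B-len; R⁺⁺ row «lengths ≥ P with general coefficients»
UNCOVERED, p459189 is a non-covering threshold), x2 (`μψ` / E-032-class pieces → §E p2), x3 (unbalanced band). Nothing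
in this Part bears on (u1)–(u3). FRAMING: the programme SEARCHES and TYPES; no claim about Landau–Siegel zeros, Theorems
1–2 of arXiv:2211.02515 or a repaired Margin232 until a kernel theorem says so. -/

/-- **The word's families, v6** = v5 ++ `[familyGramBlockAll, familyGramBlockDict]` (MIXED: model-currency row +
dictionary row). [cite: Zhang2022LandauSiegel, §2 (2.32)–(2.33); §7 Prop 7.1 (7.2)] -/
def bmultiWord6 : List DesignFamily := bmultiWord5 ++ [familyGramBlockAll, familyGramBlockDict]

/-- **v6 is decided** (`bmultiWord5_decided`, `familyGramBlockAll_decided`, `familyGramBlockDict_decided`).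
[cite: Zhang2022LandauSiegel, §2 (2.32)–(2.33)] -/
theorem bmultiWord6_decided : ClassDecided bmultiWord6 :=
  classDecided_append.2 ⟨bmultiWord5_decided,
    classDecided_cons familyGramBlockAll_decided (classDecided_cons familyGramBlockDict_decided classDecided_nil)⟩

/-- `R⁺ ++ bmultiWord6` is decided. [cite: Zhang2022LandauSiegel, §2 (2.32)–(2.33)] -/
theorem rplus_bmultiWord6_decided : ClassDecided (Rplus ++ bmultiWord6) :=
  classDecided_append.2 ⟨rplus_decided, bmultiWord6_decided⟩

/-- v5 is a prefix of v6. [cite: Zhang2022LandauSiegel, §2 (2.32)–(2.33)] -/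
theorem bmultiWord5_sub_bmultiWord6 : ∀ F ∈ bmultiWord5, F ∈ bmultiWord6 :=
  fun _ hF => List.mem_append.2 (Or.inl hF)

/-- both MIXED rows are members of v6. [cite: Zhang2022LandauSiegel, §2 (2.32)–(2.33)] -/
theorem mem_bmultiWord6_mixed : familyGramBlockAll ∈ bmultiWord6 ∧ familyGramBlockDict ∈ bmultiWord6 :=
  ⟨List.mem_append.2 (Or.inr (by simp)), List.mem_append.2 (Or.inr (by simp))⟩

/-- **Designs of `K_multi`, v6**: v5 plus `mixed` (`KnifeEdge.GramDesign`, the MIXED `k`-block members).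
[cite: Zhang2022LandauSiegel, §2 (2.32)–(2.33); §7 Prop 7.1 (7.2)] -/
inductive BmultiDesign6 : Type
  | ofV5 (d : BmultiDesign5)
  | mixed (d : GramDesign)

/-- Membership, v6 (`mixed`: every piece admissible — `KnifeEdge.GramDesign.InClass`; nothing about the matrix).
[cite: Zhang2022LandauSiegel, §2 (2.32)–(2.33); §7 Prop 7.1 (7.2)] -/
def KBmulti6 : BmultiDesign6 → Prop
  | .ofV5 d => KBmulti5 d
  | .mixed d => familyGramBlockDict.InClass d

/-- Verdict, v6 (`mixed`: the dictionary row's verdict AND the model-currency row's verdict).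
[cite: Zhang2022LandauSiegel, §2 (2.32)–(2.33); §7 Prop 7.1 (7.2)] -/
def VBmulti6 : BmultiDesign6 → Prop
  | .ofV5 d => VBmulti5 d
  | .mixed d => familyGramBlockDict.Verdict d ∧ familyGramBlockAll.Verdict d

/-- **`K_multi` as one family, v6.** [cite: Zhang2022LandauSiegel, §2 (2.32)–(2.33)] -/
def familyBmulti6 : DesignFamily where
  Design := BmultiDesign6
  InClass := KBmulti6
  Verdict := VBmulti6

/-- **v6 is decided.** [cite: Zhang2022LandauSiegel, §2 (2.32)–(2.33)] -/
theorem familyBmulti6_decided : familyBmulti6.Decided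
  | .ofV5 d, h => familyBmulti5_decided d h
  | .mixed d, h => ⟨familyGramBlockDict_decided d h, familyGramBlockAll_decided d h⟩

/-- `R⁺ ++ [K_multi v6]` is decided. [cite: Zhang2022LandauSiegel, §2 (2.32)–(2.33)] -/
theorem rplus_bmulti6_decided : ClassDecided (Rplus ++ [familyBmulti6]) :=
  rplus_extend familyBmulti6_decided

/-- v5 embeds into v6 unchanged. [cite: Zhang2022LandauSiegel, §2 (2.32)–(2.33)] -/
theorem kbmulti6_ofV5_iff (d : BmultiDesign5) :
    (KBmulti6 (.ofV5 d) ↔ KBmulti5 d) ∧ (VBmulti6 (.ofV5 d) ↔ VBmulti5 d) :=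
  ⟨Iff.rfl, Iff.rfl⟩

/-- membership of a MIXED member is piecewise admissibility (the class of both Gram rows).
[cite: Zhang2022LandauSiegel, §7 Prop 7.1 (7.2)] -/
theorem kbmulti6_mixed_iff (d : GramDesign) :
    KBmulti6 (.mixed d) ↔ ∀ i, (d.piece i).Admissible :=
  Iff.rfl

/-- C4 for `mixed` (GRAM-WITNESS v1 §1's member: bulk `ϰ(1,5/2)`, plateau band `½`, multi-lambda-001's Λ-piece; and
the wall-value-`1` / ramp / interior-step member — each with ANY model matrix). [cite: Zhang2022LandauSiegel, §7 Prop 7.1 (7.2)] -/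
theorem kbmulti6_mixed_witnesses (G : Matrix (Fin 3) (Fin 3) ℂ) :
    KBmulti6 (.mixed (gramWitness G)) ∧ KBmulti6 (.mixed ⟨3, gramWitnessPieces', G⟩) :=
  ⟨gramWitness_inClass G, gramWitness'_inClass G⟩

/-- The MIXED slot is LOAD-BEARING: unslotted, the GRAM-WITNESS member with model matrix `gramThree` closes
(pointer to `KnifeEdge.familyGramBlockAll_unslotted_fails`). [cite: Zhang2022LandauSiegel, §7 Prop 7.1 (7.2)] -/
theorem bmulti6_mixed_slot_loadBearing :
    ¬ (∀ d : GramDesign, d.InClass → ∀ x : Fin d.k → ℂ, ¬ (gramForm d.gram x < 0)) :=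
  familyGramBlockAll_unslotted_fails

/-- C2 pointers: the word's one-block model families are instances of the MIXED row BY TERM (M1, M2, M3-wall).
[cite: Zhang2022LandauSiegel, §7 Prop 7.1 (7.2)] -/
theorem bmulti6_oneBlock_of_gram :
    familyJumpBlockAll.Decided ∧ familyLambdaBlockAll.Decided ∧ familyWallBand.Decided :=
  ⟨familyJumpBlockAll_decided_of_gram, familyLambdaBlockAll_decided_of_gram, familyWallBand_decided_of_gram⟩

end Repair

end Literature.NumberTheory.LFunctions.Zhang2022
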